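import Summits.CriticalPhenomena.CardyFormulaZ2.Theses.CardySelfDualSegment
import Summits.CriticalPhenomena.CardyFormulaZ2.Theorems.CardySelfDualSegmentUniformBoxCrossingStubRender
import Summits.CriticalPhenomena.CardyFormulaZ2.Theorems.CardySelfDualSegmentUniformBoxCrossingStubGlue
import Literature.Probability.Percolation.RSW
import HarnessLib

/-!
# The kernel of line `Sketch` is NECESSARY: `UniformBoxCrossing` implies the t-uniform Non-Slant lemma
# (crux stmt-CriticalPhenomena-5476)

The reshaped skeleton of line `Sketch` reduces the crux
`Summit.CriticalPhenomena.CardyFormulaZ2.Theses.CardySelfDualSegment.UniformBoxCrossing` to ONE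
kernel statement, the t-uniform Non-Slant lemma for the corner models `M_t = cornerPercolation t`
(Bollobás–Riordan 2010, Lemma 5.2, without the mirror): the engine `NonSlant ⇒ UniformBoxCrossing`
is landed (`…UniformBoxCrossingEngine.lean`). This file proves the CONVERSE,
`nonSlant_of_uniformBoxCrossing : UniformBoxCrossing → (t-uniform Non-Slant)`, so that the kernel
is exactly as strong as the crux — promoting the kernel to an item loses nothing.

Proof: a top–bottom crossing of the lattice rectangle `[0, W] × [0, n]` with `W = ⌊3n/5⌋` is an
open path of the square `[0, n]²` from a bottom vertex `x` to a top vertex `y` with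
`|y₀ - x₀| ≤ W`, i.e. a non-slant crossing (`tbCrossing_subset_nonSlantSet`); by transposition
`M_t(TB([0,W]×[0,n])) = M_t(LR([0,n]×[0,W]))` (`cornerPercolation_real_tbCrossing`), a hard-way
crossing of aspect ratio `≥ 5/3`, which the box-crossing bounds of the crux control uniformly in
`t`: with `ρ = 3` and scale `N = ⌈n/2⌉`, the embedded horizontal crossing of `[0, 3N] × [0, N]`
drawn on `√2 ℤ²` forces a lattice crossing of `[0, ⌈3N/√2⌉] × [0, ⌊N/√2⌋]`
(`cornerPercolation_real_embRectCrossing_le_real_lrCrossing` of the render file), and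
`⌈3N/√2⌉ ≥ n`, `⌊N/√2⌋ ≤ ⌊3n/5⌋` (antitonicity in the width, monotonicity in the height).
-/

namespace Summit.CriticalPhenomena.CardyFormulaZ2.Cruxes.UniformBoxCrossing.NonSlantLine

open MeasureTheory Literature.Probability.Percolation Literature.Probability.LatticeModels
open Summit.CriticalPhenomena.CardyFormulaZ2.Theses.CardySelfDualSegment

/-- **A vertical crossing of the thin rectangle `[0, W] × [0, n]`, `5 W ≤ 3 n`, is a non-slant
crossing of the square `[0, n]²`.** [cite: BollobasRiordan2010, §5.1 Lemma 5.2] -/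
theorem tbCrossing_subset_nonSlantSet {W n : ℕ} (hW : 5 * W ≤ 3 * n) (hWn : W ≤ n) :
    tbCrossing W n ⊆ {ω | ∃ x ∈ bottomSide n n, ∃ y ∈ topSide n n,
      5 * |y 0 - x 0| ≤ 3 * (n : ℤ) ∧ ω ∈ openConnIn (↑(rectangle n n)) x y} := by
  rintro ω ⟨x, hx, y, hy, hconn⟩
  simp only [Finset.mem_coe, bottomSide, topSide, Finset.mem_filter, mem_rectangle_iff] at hx hy
  refine ⟨x, ?_, y, ?_, ?_, openConnIn_mono ?_ _ _ hconn⟩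
  · simp only [bottomSide, Finset.mem_filter, mem_rectangle_iff]; omega
  · simp only [topSide, Finset.mem_filter, mem_rectangle_iff]; omega
  · rw [show (5 : ℤ) * |y 0 - x 0| = |5 * (y 0 - x 0)| by rw [abs_mul]; norm_num, abs_le]
    constructor <;> nlinarith [hx.1.1, hx.1.2.1, hy.1.1, hy.1.2.1, hW]
  · intro z hz
    rw [Finset.mem_coe, mem_rectangle_iff] at hz ⊢
    omega

/-- `√2` bounds used below. [folklore] -/
theorem sqrt_two_bounds : (7 / 5 : ℝ) < Real.sqrt 2 ∧ Real.sqrt 2 < (3 / 2 : ℝ) := by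
  constructor
  · rw [show (7 / 5 : ℝ) = Real.sqrt ((7 / 5) ^ 2) by rw [Real.sqrt_sq (by norm_num)]]
    exact Real.sqrt_lt_sqrt (by norm_num) (by norm_num)
  · rw [show (3 / 2 : ℝ) = Real.sqrt ((3 / 2) ^ 2) by rw [Real.sqrt_sq (by norm_num)]]
    exact Real.sqrt_lt_sqrt (by norm_num) (by norm_num)

/-- **The crux forces uniform hard-way crossings of lattice rectangles of aspect ratio `5/3`**:
from `UniformBoxCrossing` there are `c > 0` and `n₀` with `M_t(LR([0, n] × [0, ⌊3n/5⌋])) ≥ c`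
for all `t` and `n ≥ n₀` (box-crossing bounds at `ρ = 3`, scale `⌈n/2⌉`, drawn on `√2 ℤ²`,
converted to the lattice by `cornerPercolation_real_embRectCrossing_le_real_lrCrossing`).
[cite: GrimmettManolescu2014, §2.3] -/
theorem lrCrossing_three_fifths_of_uniformBoxCrossing (h : UniformBoxCrossing) :
    ∃ c : ℝ, 0 < c ∧ ∃ n₀ : ℕ, ∀ (t : unitInterval) (n : ℕ), n₀ ≤ n →
      c ≤ (cornerPercolation t).real (lrCrossing n (3 * n / 5)) := by
  obtain ⟨c, hc, n₀, hbox⟩ := h 3 (by norm_num)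
  refine ⟨c, hc, 2 * n₀ + 10, fun t n hn => ?_⟩
  have hs := sqrt_two_bounds
  set N : ℕ := (n + 1) / 2 with hN
  have hN₀ : n₀ ≤ N := by omega
  have hNn : (n : ℝ) ≤ 2 * N := by
    have : n ≤ 2 * N := by omega
    exact_mod_cast this
  have hNn' : (2 : ℝ) * N ≤ n + 1 := by
    have : 2 * N ≤ n + 1 := by omega
    exact_mod_cast this
  -- the box-crossing bound at scale `N`, translation `w = 0`
  have hB : c ≤ (cornerPercolation t).real
      (embRectCrossing (fun v => squareLatticeEmbedding.z v - 0) (3 * (N : ℕ)) N) :=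
    ((hbox t) N hN₀ 0).1.1
  -- lattice conversion
  set iR : ℤ := ⌈3 * (N : ℝ) / Real.sqrt 2⌉ with hiR
  set jT : ℤ := ⌊(N : ℝ) / Real.sqrt 2⌋ with hjT
  have hsqrt : (0 : ℝ) < Real.sqrt 2 := by linarith [hs.1]
  have hconv := cornerPercolation_real_embRectCrossing_le_real_lrCrossing t 0 (3 * N) N 0 iR 0 jT
    (fun s hs' => by
      simp only [Complex.zero_re] at hs'
      have : (s : ℝ) ≤ 0 := by nlinarith
      exact_mod_cast this)
    (fun s hs' => by
      simp only [Complex.zero_re, zero_add] at hs'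
      rw [hiR]
      refine Int.ceil_le.2 ?_
      rw [div_le_iff₀ hsqrt]
      linarith)
    (by rw [hiR]; positivity)
    (fun s hs' => by
      simp only [Complex.zero_im] at hs'
      have : (0 : ℝ) ≤ s := by nlinarith
      exact_mod_cast this)
    (fun s hs' => by
      simp only [Complex.zero_im, zero_add] at hs'
      rw [hjT]
      refine Int.le_floor.2 ?_
      rw [le_div_iff₀ hsqrt]
      linarith)
  have hiR0 : (iR - 0).toNat = iR.toNat := by rw [sub_zero]
  have hjT0 : (jT - 0).toNat = jT.toNat := by rw [sub_zero]
  rw [hiR0, hjT0] at hconv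
  -- `n ≤ ⌈3N/√2⌉` and `⌊N/√2⌋ ≤ ⌊3n/5⌋`
  have hwidth : n ≤ iR.toNat := by
    have h1 : (n : ℝ) ≤ 3 * (N : ℝ) / Real.sqrt 2 := by
      rw [le_div_iff₀ hsqrt]; nlinarith
    have h2 : (n : ℤ) ≤ iR := by
      rw [hiR]
      have := Int.le_ceil (3 * (N : ℝ) / Real.sqrt 2)
      exact_mod_cast h1.trans this
    omega
  have hheight : jT.toNat ≤ 3 * n / 5 := by
    have hn10 : (10 : ℝ) ≤ n := by exact_mod_cast (show 10 ≤ n by omega)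
    have h1 : (N : ℝ) / Real.sqrt 2 ≤ 3 * (n : ℝ) / 5 - 1 := by
      rw [div_le_iff₀ hsqrt]
      nlinarith [hs.1, hNn', hn10]
    have h2 : jT ≤ ((3 * n / 5 : ℕ) : ℤ) := by
      rw [hjT]
      have h3 : ((3 * n / 5 : ℕ) : ℝ) ≥ 3 * (n : ℝ) / 5 - 1 := by
        have h4 : (3 * n / 5 : ℕ) * 5 + 5 > 3 * n := by omega
        have h5 : ((3 * n / 5 : ℕ) : ℝ) * 5 + 5 > 3 * (n : ℝ) := by exact_mod_cast h4
        linarith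
      have h6 : ⌊(N : ℝ) / Real.sqrt 2⌋ ≤ ⌊((3 * n / 5 : ℕ) : ℝ)⌋ := Int.floor_le_floor (by linarith)
      rwa [Int.floor_natCast] at h6
    omega
  calc c ≤ _ := hB
    _ ≤ (cornerPercolation t).real (lrCrossing iR.toNat jT.toNat) := hconv
    _ ≤ (cornerPercolation t).real (lrCrossing n jT.toNat) :=
        cornerPercolation_real_lrCrossing_anti_left t hwidth _
    _ ≤ (cornerPercolation t).real (lrCrossing n (3 * n / 5)) :=
        measureReal_mono (lrCrossing_mono_right n hheight)

/-- **The kernel is necessary: `UniformBoxCrossing` implies the t-uniform Non-Slant lemma** (the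
registered kernel statement of line `Sketch`, verbatim). With the landed engine
(`uniformBoxCrossing_of_nonSlant`) the kernel is therefore EQUIVALENT to the crux.
[cite: BollobasRiordan2010, §5.1 Lemma 5.2] -/
theorem nonSlant_of_uniformBoxCrossing (h : UniformBoxCrossing) :
    ∃ c : ℝ, 0 < c ∧ ∃ n₀ : ℕ, ∀ (t : unitInterval) (n : ℕ), n₀ ≤ n →
      c ≤ (cornerPercolation t).real {ω | ∃ x ∈ bottomSide n n, ∃ y ∈ topSide n n,
        5 * |y 0 - x 0| ≤ 3 * (n : ℤ) ∧ ω ∈ openConnIn (↑(rectangle n n)) x y} := by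
  obtain ⟨c, hc, n₀, hLR⟩ := lrCrossing_three_fifths_of_uniformBoxCrossing h
  refine ⟨c, hc, n₀, fun t n hn => (hLR t n hn).trans ?_⟩
  rw [← cornerPercolation_real_tbCrossing t n (3 * n / 5)]
  exact measureReal_mono (tbCrossing_subset_nonSlantSet (by omega) (by omega))

/-- Statement form of `nonSlant_of_uniformBoxCrossing` — a registered step the LINE POSITS and
proves right below (`kernelNecessary_holds`); not a literature fact, never to be relocated. -/
def KernelNecessaryStatement : Prop :=
  UniformBoxCrossing →
    ∃ c : ℝ, 0 < c ∧ ∃ n₀ : ℕ, ∀ (t : unitInterval) (n : ℕ), n₀ ≤ n →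
      c ≤ (cornerPercolation t).real {ω | ∃ x ∈ bottomSide n n, ∃ y ∈ topSide n n,
        5 * |y 0 - x 0| ≤ 3 * (n : ℤ) ∧ ω ∈ openConnIn (↑(rectangle n n)) x y}

/-- The kernel is necessary, statement form. [cite: BollobasRiordan2010, §5.1 Lemma 5.2] -/
theorem kernelNecessary_holds : KernelNecessaryStatement := nonSlant_of_uniformBoxCrossing

end Summit.CriticalPhenomena.CardyFormulaZ2.Cruxes.UniformBoxCrossing.NonSlantLine
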